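import Literature.MathematicalPhysics.QuantumFieldTheory.Balaban1983to89.B8BlockConstantLiftRec
import Literature.MathematicalPhysics.QuantumFieldTheory.Balaban1983to89.B8Eq191FlatLettersDentedCubeMemberRec
import Literature.MathematicalPhysics.QuantumFieldTheory.Balaban1983to89.B8BlockConstantLiftStabilityRec

/-!
# `Balaban1983to89.B8BlockConstantLiftDentedRec` — the block-constant lift of (B′-1) AT THE DENTED RECORD TOWER: every cell datum `X(j, y)` on the dented cells `Λ′_j` of
# [Balaban1985Variational] (148)–(150) ([Balaban1985RegularSpaces] (1.131)) is realised by a gauge transformation constant `= X(j, y)` on the centred block tower under every dented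
# cell, `= 1` off `Ω′₀`, with values in `{1} ∪ range X` — the `h` of the pre-composed Theorem-4 input `(U₀″)^{h}`; item (B′-4) (datum realisation) of the plan's road (B′) for
# director-ym №310–№312a branch (ii) case (β) (pen dag-n05-e g42)

statement-level skeleton of published theorems with citation tags; proofs where landed; nothing here is a claim about the Yang–Mills mass gap

CITATION HEADER (lean-in-tree rule).  Cell `pub-ymgap` (HUMAN RULING D-0062), «N05-REC» road, ROAD (B′) («axiality-preserving block-constant pre-composition of the Theorem-4
input»; licence line: variant, our proof — NOT a printed clause).  (B′-1) ✓`B8BlockConstantLiftRec.exists_blockConstant_of_disjoint` realises any cell data for PAIRWISE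
TOWER-DISJOINT cells; the dented record cells ARE pairwise tower-disjoint (`B8Eq191FlatLettersDentedCubeMemberRec.towers_disjoint_dented`, the record twin of the engine's
`towers_disjoint_dented`), and a fine site under a dented cell lies in `Ω′₀` (`Node00.CubeB8DZ.under_lamS_top_subset` at the top, `B8Eq131CubesRec.mem_cube_iff` below it).  THIS
FILE composes the three: the binders `(h) (hconst) (h = 1 off Ω′₀) (h ∈ G)` of the pre-composed crown (✓`B8Prop6DentedCubeMemberGammaPrecompProp6Rec` … `…ScalarGammaSU25PrecompRec`)
are INHABITED for every `G`-valued cell datum `X`; the oscillation binders `(hoscj) (hosc0)` are the junction's (the data's variation between adjacent cells — N07's θ-row).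
[15] = [Balaban1985Variational] (148)–(150) p. 301; [6] = [Balaban1985RegularSpaces] (1.131) p. 99, (1.29) p. 81, (1.19) p. 79, p. 98; [3] = [Balaban1985Averaging] (78)–(81)
p. 30; [I] = [Balaban1987RG1] (0.3)–(0.4), (0.6) pp. 252–253.  `--kind proof --supports stmt-QuantumFields-20541` (K0⁷; count-neutral; no def).
REUSED BY NAME: `B8BlockConstantLiftRec.exists_blockConstant_of_disjoint`, `B8Eq191FlatLettersDentedCubeMemberRec.{towers_disjoint_dented, sq_subset_zero}`,
`B8DentedCubeMemberZdRec.{lamST_top_apply, inBox_sq_of_mem_lamST}`, `Node00.CubeB8DZ.{under_lamS_top_subset, sq_of_lt}`, `B8Eq131CubesRec.mem_cube_iff`,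
`B8Eq119TwistedAxialRec.underZ_iff_flmZ_eq`.

WHAT IS PROVED (sorry-free).  §1 `mem_sq_zero_of_underZ_lamS` — a fine site under a dented cell `y ∈ Λ′_j` (`j ≤ k`) lies in `Ω′₀`; `towers_disjoint_lamS_underZ` — the dented
cells' block towers are pairwise disjoint (in the `UnderZ` letters of (B′-1)).  §2 ★★ `exists_blockConstant_dented` — for every datum `X : ℕ → Site → G` there is `h : Site → G`,
constant `= X(j, y)` under every dented cell (`j ≤ k`, hence in particular `1 ≤ j ≤ k`), `= 1` off `Ω′₀`, with values in `{1} ∪ range X`; ★★ `exists_blockConstant_dented_mem` —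
the same with `h` valued in a subgroup `S` when the data are.
HONEST SCOPE.  Finite bookkeeping; NO estimate of Bałaban's; the oscillation of `h` (the binders `hoscj`, `hosc0` of the pre-composed crown) is NOT bounded here — it is the
junction's datum estimate; `HThm4Rec*` CONDITIONAL; N05 DISCHARGED OF RECORD since R467 (count-neutral record-level work), N07 NOT discharged; counts unmoved (typed 28∕28 ·
discharged 8∕28); one finite 𝕋⁴ programme at fixed ε, `G = SU(2)` of record — nothing continuum ∕ ℝ⁴ ∕ OS ∕ mass gap ∕ Clay.  No `def`, no `instance`, no `notation`, no `sorry`.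

v1.1 §3 APPEND (dag-n05-e g42, same evening; plan g93 (g-2) option (m-2″): the junction-input kit of (B′-4) in ONE file, no new road basename).  ★★ THE OSCILLATION ROW OF THEOREM 4's
GAUGE TRANSFORMATION AT EVERY LEVEL — the derived «u₀-row» the N05 → N07 junction asked for (dag-n07-w3 g13 design note): [6] Theorem 4 ∕ Prop. 6 print for `u` ONLY (1.29); the
record's centred average (0.4) is EXACTLY covariant under transformations SAMPLED AT BLOCK CENTRES ([I] (0.6), [3] (11); `BlockAveragingZdCovariance.avgIterZ_gaugeAct_units`), so for
`U₁ = W^{u⁻¹}`: `u(Lⁱz)⁻¹·W̄ⁱ(z,μ)·u(Lⁱ(z+e_μ)) = Ū₁ⁱ(z,μ)` and unit-ball algebra ([3] (45)) gives §3 `norm_sub_le_of_conj_near_one` (`‖a − b‖ ≤ ‖a⁻¹Vb − 1‖ + ‖V − 1‖`, `a, b ∈ U1`),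
★★ `norm_centre_sub_centre_le_of_avgIterZ` (`‖u(Lⁱz) − u(Lⁱ(z+e_μ))‖ ≤ ‖\overline{W^{u⁻¹}}ⁱ(z,μ) − 1‖ + ‖W̄ⁱ(z,μ) − 1‖`, every level `i`, every bond, `u` `U1`-valued, ANY `W`) and
`…_unitaryUnits`.  HONEST: two lines of algebra over an exact identity; the two right-hand deviations (`≤ 2r·L^{i−j}` from the crown's clause 5; the datum's axial-inside-blocks +
(1.34) bound) are the junction's, NOT here.  §1–§2 above byte-identical to v1.0 (✓p748893).
-/

set_option autoImplicit false

noncomputable section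

namespace Literature.MathematicalPhysics.QuantumFieldTheory.Balaban1983to89.B8BlockConstantLiftDentedRec

open B7Prop1Explicit hiding Site
open B7Prop1Explicit renaming Site → SiteZ
open B7Prop1Local (InBox)
open B8Eq119TwistedAxialRec (UnderZ flmZ underZ_iff_flmZ_eq)
open B8Eq131CubesRec (cubeZ mem_cube_iff)
open B8BlockConstantLiftRec (exists_blockConstant_of_disjoint)
open B8Eq191FlatLettersDentedCubeMemberRec (towers_disjoint_dented sq_subset_zero)
open B8DentedCubeMemberZdRec (lamST_top_apply inBox_sq_of_mem_lamST)
open Node00 (CubeB8DZ)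

variable {d L K : ℕ} {Ω : ℕ → Set (SiteZ d)}

/-! ## §1  Towers under dented cells: inside `Ω′₀`, pairwise disjoint -/

/-- **A fine site under a dented cell lies in `Ω′₀`**: for `y ∈ Λ′_j` (`j ≤ k`) and `x ∈ Bʲ(y)` (centred), `x ∈ Ω′_j ⊆ Ω′₀` — below the top `Ω′_j = □_j` and «□_j is a sum of
the big blocks» ([6] p. 98, `mem_cube_iff`); at the top the dented cell's block lies in `□_k ∩ Ω_k` (`under_lamS_top_subset`). [cite: Balaban1985RegularSpaces, p.98, (1.131) p.99, (1.19) p.79; Balaban1985Variational, (148)–(150) p.301; Balaban1987RG1, (0.3) p.252] -/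
theorem mem_sq_zero_of_underZ_lamS (hL : Odd L) (c : CubeB8DZ d L K Ω) {j : ℕ} (hj : j ≤ c.k) {y x : SiteZ d} (hy : y ∈ c.lamS j)
    (hx : UnderZ L j y x) : x ∈ c.sq 0 := by
  rcases lt_or_eq_of_le hj with hlt | rfl
  · have hbox : InBox (B8Eq131CubesRec.sqLoZ L c.a c.ρ c.k j) (B8Eq131CubesRec.sqHiZ L c.a c.M c.ρ c.k j) y := by
      have hy' : y ∈ c.lamST c.k j := by rw [lamST_top_apply c j]; exact hy
      exact inBox_sq_of_mem_lamST c hy'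
    have hxj : x ∈ c.sq j := by
      rw [c.sq_of_lt hlt]
      exact (mem_cube_iff hL).2 ⟨y, hbox, hx⟩
    exact sq_subset_zero c hL j hxj
  · exact sq_subset_zero c hL c.k (c.under_lamS_top_subset hL hy hx)

/-- **THE DENTED CELLS' BLOCK TOWERS ARE PAIRWISE DISJOINT** (the `hdisj` binder of (B′-1) `exists_blockConstant_of_disjoint` at `Λ := c.lamS`): if `x ∈ Bʲ(y) ∩ B^{j′}(y′)` for
dented cells `y ∈ Λ′_j`, `y′ ∈ Λ′_{j′}` then `j = j′` and `y = y′` — the record's `towers_disjoint_dented` read in the `UnderZ` letters (`underZ_iff_flmZ_eq`) with §1 supplying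
`x ∈ Ω′₀`. [cite: Balaban1985Variational, (148)–(150) p.301 («Λ′_j», disjoint by construction); Balaban1985RegularSpaces, (1.131) p.99, (1.19) p.79; Balaban1987RG1, (0.3) p.252] -/
theorem towers_disjoint_lamS_underZ (hL : Odd L) (c : CubeB8DZ d L K Ω) :
    ∀ j, j ≤ c.k → ∀ j', j' ≤ c.k → ∀ y ∈ c.lamS j, ∀ y' ∈ c.lamS j', ∀ x, UnderZ L j y x → UnderZ L j' y' x → j = j' ∧ y = y' := by
  intro j hj j' hj' y hy y' hy' x hx hx'
  have hx0 : x ∈ c.sq 0 := mem_sq_zero_of_underZ_lamS hL c hj hy hx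
  have hyT : y ∈ c.lamST c.k j := by rw [lamST_top_apply c j]; exact hy
  have hyT' : y' ∈ c.lamST c.k j' := by rw [lamST_top_apply c j']; exact hy'
  exact towers_disjoint_dented c hL le_rfl j hj j' hj' y hyT y' hyT' x hx0 ((underZ_iff_flmZ_eq hL j y x).1 hx)
    ((underZ_iff_flmZ_eq hL j' y' x).1 hx')

/-! ## §2  The block-constant lift of a cell datum on the dented record tower -/

/-- ★★ **EVERY CELL DATUM ON THE DENTED RECORD TOWER IS REALISED BY A BLOCK-CONSTANT GAUGE TRANSFORMATION** — (B′-1) at `Λ := {Λ′_j}`: for every `X : ℕ → Site → G` there is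
`h : Site → G` with `h(x) = X(j, y)` for every `x ∈ Bʲ(y)`, `y ∈ Λ′_j`, `j ≤ k` (in particular for `1 ≤ j ≤ k`, the `hconst` binder of the pre-composed crown); `h = 1` off
`Ω′₀` (indeed off the towers); and every value of `h` is `1` or some `X(j, y)` with `y ∈ Λ′_j`, `j ≤ k`.  With `X(j, y) := R̄ʲ(g)(y)` this is the `h` of the pre-composed
Theorem-4 input `(U₀″)^{h}` whose (1.29)-data are `X` exactly ((B′-1) `rbar_one_eq_data_of_blockConstant`, (B′-5)).
[cite: Balaban1985RegularSpaces, (1.29) p.81, (1.131) p.99, (1.19) p.79; Balaban1985Variational, (148)–(152) p.301; Balaban1985Averaging, (78)–(81) p.30; Balaban1987RG1, (0.3)–(0.4) p.252, (0.6) p.253] -/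
theorem exists_blockConstant_dented {G : Type*} [Group G] (hL : Odd L) (c : CubeB8DZ d L K Ω) (X : ℕ → SiteZ d → G) :
    ∃ h : SiteZ d → G,
      (∀ j, j ≤ c.k → ∀ y ∈ c.lamS j, ∀ x, UnderZ L j y x → h x = X j y) ∧
      (∀ j, 1 ≤ j → j ≤ c.k → ∀ y ∈ c.lamS j, ∀ x, UnderZ L j y x → h x = X j y) ∧
      (∀ x, x ∉ c.sq 0 → h x = 1) ∧
      (∀ x, h x = 1 ∨ ∃ j, j ≤ c.k ∧ ∃ y ∈ c.lamS j, h x = X j y) := by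
  obtain ⟨h, hcst, hoff, hval⟩ := exists_blockConstant_of_disjoint L c.k c.lamS X (towers_disjoint_lamS_underZ hL c)
  refine ⟨h, hcst, fun j _ hj y hy x hx => hcst j hj y hy x hx, fun x hx => hoff x ?_, hval⟩
  rintro ⟨j, hj, y, hy, hxy⟩
  exact hx (mem_sq_zero_of_underZ_lamS hL c hj hy hxy)

/-- ★★ **THE SAME WITH VALUES IN A SUBGROUP**: if every datum `X(j, y)` (`y ∈ Λ′_j`, `j ≤ k`) lies in a subgroup `S ≤ G` (print's `G = SU(N)` inside `U(N)`, or `G` inside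
`𝔸ˣ`), the realising `h` is `S`-valued — the `(∀ x, h x ∈ G)` binder of the pre-composed crown. [cite: Balaban1985Averaging, p.20 («a Lie subgroup G of a unitary group U(N)»); Balaban1985RegularSpaces, p.76, (1.29) p.81; Balaban1985Variational, (148)–(152) p.301] -/
theorem exists_blockConstant_dented_mem {G : Type*} [Group G] (hL : Odd L) (c : CubeB8DZ d L K Ω) (S : Subgroup G) (X : ℕ → SiteZ d → G)
    (hX : ∀ j, j ≤ c.k → ∀ y ∈ c.lamS j, X j y ∈ S) :
    ∃ h : SiteZ d → G, (∀ x, h x ∈ S) ∧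
      (∀ j, 1 ≤ j → j ≤ c.k → ∀ y ∈ c.lamS j, ∀ x, UnderZ L j y x → h x = X j y) ∧
      (∀ x, x ∉ c.sq 0 → h x = 1) := by
  obtain ⟨h, -, hcst, hoff, hval⟩ := exists_blockConstant_dented hL c X
  refine ⟨h, fun x => ?_, hcst, hoff⟩
  rcases hval x with h1 | ⟨j, hj, y, hy, hxy⟩
  · rw [h1]; exact S.one_mem
  · rw [hxy]; exact hX j hj y hy

/-! ## §3 (v1.1)  The oscillation of Theorem 4's gauge transformation at every level from the two averaged fields -/

section Oscillation

open B7Prop2Explicit (unitaryUnits unitaryUnits_le_U1)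
open B7AvgGaugeCovariance (uLev uLev_apply)
open BlockAveragingZd (avgIterZ)
open BlockAveragingZdCovariance (avgIterZ_gaugeAct_units)

/-- **`‖a − b‖ ≤ ‖a⁻¹·V·b − 1‖ + ‖V − 1‖` for `a, b` in the unit-ball group `U1`**: `a − b = a·(1 − a⁻¹Vb) + (V − 1)·b`. [cite: Balaban1985Averaging, (45) p.24 (bookkeeping)] -/
theorem norm_sub_le_of_conj_near_one {𝔸 : Type*} [NormedRing 𝔸] [NormOneClass 𝔸] {a b : 𝔸ˣ} (ha : a ∈ U1 𝔸) (hb : b ∈ U1 𝔸) (V : 𝔸) :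
    ‖(a : 𝔸) - (b : 𝔸)‖ ≤ ‖((a⁻¹ : 𝔸ˣ) : 𝔸) * V * (b : 𝔸) - 1‖ + ‖V - 1‖ := by
  have hsplit : (a : 𝔸) - (b : 𝔸) = (a : 𝔸) * (1 - ((a⁻¹ : 𝔸ˣ) : 𝔸) * V * (b : 𝔸)) + (V - 1) * (b : 𝔸) := by
    rw [mul_sub, mul_one, sub_mul, one_mul, ← mul_assoc, ← mul_assoc, Units.mul_inv, one_mul]
    abel
  rw [hsplit]
  calc ‖(a : 𝔸) * (1 - ((a⁻¹ : 𝔸ˣ) : 𝔸) * V * (b : 𝔸)) + (V - 1) * (b : 𝔸)‖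
      ≤ ‖(a : 𝔸) * (1 - ((a⁻¹ : 𝔸ˣ) : 𝔸) * V * (b : 𝔸))‖ + ‖(V - 1) * (b : 𝔸)‖ := norm_add_le _ _
    _ ≤ ‖(a : 𝔸)‖ * ‖1 - ((a⁻¹ : 𝔸ˣ) : 𝔸) * V * (b : 𝔸)‖ + ‖V - 1‖ * ‖(b : 𝔸)‖ := add_le_add (norm_mul_le _ _) (norm_mul_le _ _)
    _ ≤ 1 * ‖1 - ((a⁻¹ : 𝔸ˣ) : 𝔸) * V * (b : 𝔸)‖ + ‖V - 1‖ * 1 := by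
        gcongr
        · exact ha.1
        · exact hb.1
    _ = ‖((a⁻¹ : 𝔸ˣ) : 𝔸) * V * (b : 𝔸) - 1‖ + ‖V - 1‖ := by rw [one_mul, mul_one, norm_sub_rev]

/-- ★★ **THE OSCILLATION OF THEOREM 4's GAUGE TRANSFORMATION BETWEEN ADJACENT BLOCK CENTRES, AT EVERY LEVEL, IS BOUNDED BY THE DEVIATIONS FROM `1` OF THE TWO FIELDS' RECORD
AVERAGES**: for `u` valued in the unit-ball group `U1` and ANY configuration `W`, with `U₁ := W^{u⁻¹}` (`gaugeAct u⁻¹ W`), at every level `i` and every level-`i` bond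
`⟨z, z + e_μ⟩`: `‖u(Lⁱ·z) − u(Lⁱ·(z + e_μ))‖ ≤ ‖Ū₁ⁱ(z, μ) − 1‖ + ‖W̄ⁱ(z, μ) − 1‖` — the (0.4) average is covariant under centre-sampled transformations ([I] (0.6), [3] (11):
`avgIterZ_gaugeAct_units`), then `norm_sub_le_of_conj_near_one`.  (Road (B′): `W = (U₀″)^h`, `u = u₀` the pre-composed crown's gauge; the two right-hand sides are the
junction's `2r·L^{i−j}` and the datum's axial-inside-blocks bounds.) [cite: Balaban1987RG1, (0.4) p.253, (0.6) p.253; Balaban1985Averaging, (8) p.18, (11) p.19, (45) p.24; Balaban1985RegularSpaces, (1.135) p.99] -/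
theorem norm_centre_sub_centre_le_of_avgIterZ {𝔸 : Type*} [NormedRing 𝔸] [NormOneClass 𝔸] [NormedAlgebra ℂ 𝔸] [CompleteSpace 𝔸] (L : ℕ)
    {u : SiteZ d → 𝔸ˣ} (hu : ∀ x, u x ∈ U1 𝔸) (W : SiteZ d → Fin d → 𝔸ˣ) (i : ℕ) (z : SiteZ d) (μ : Fin d) :
    ‖((u (((L : ℤ) ^ i) • z) : 𝔸ˣ) : 𝔸) - ((u (((L : ℤ) ^ i) • (z + e μ)) : 𝔸ˣ) : 𝔸)‖ ≤
      ‖((avgIterZ L (gaugeAct u⁻¹ W) i z μ : 𝔸ˣ) : 𝔸) - 1‖ + ‖((avgIterZ L W i z μ : 𝔸ˣ) : 𝔸) - 1‖ := by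
  have hcov : avgIterZ L (gaugeAct u⁻¹ W) i z μ = (u (((L : ℤ) ^ i) • z))⁻¹ * avgIterZ L W i z μ * u (((L : ℤ) ^ i) • (z + e μ)) := by
    rw [avgIterZ_gaugeAct_units L u⁻¹ W i]
    simp only [gaugeAct, uLev_apply, Pi.inv_apply, inv_inv]
  rw [hcov, Units.val_mul, Units.val_mul]
  exact norm_sub_le_of_conj_near_one (hu _) (hu _) _

/-- The same for a UNITARY-valued gauge transformation in a C⋆-algebra carrier (`unitaryUnits ≤ U1`). [cite: Balaban1987RG1, (0.6) p.253; Balaban1985Averaging, (45) p.24; Balaban1985RegularSpaces, (1.135) p.99] -/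
theorem norm_centre_sub_centre_le_of_avgIterZ_unitaryUnits {𝔹 : Type*} [CStarAlgebra 𝔹] [Nontrivial 𝔹] (L : ℕ) {u : SiteZ d → 𝔹ˣ} (hu : ∀ x, u x ∈ unitaryUnits 𝔹)
    (W : SiteZ d → Fin d → 𝔹ˣ) (i : ℕ) (z : SiteZ d) (μ : Fin d) :
    ‖((u (((L : ℤ) ^ i) • z) : 𝔹ˣ) : 𝔹) - ((u (((L : ℤ) ^ i) • (z + e μ)) : 𝔹ˣ) : 𝔹)‖ ≤
      ‖((avgIterZ L (gaugeAct u⁻¹ W) i z μ : 𝔹ˣ) : 𝔹) - 1‖ + ‖((avgIterZ L W i z μ : 𝔹ˣ) : 𝔹) - 1‖ :=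
  norm_centre_sub_centre_le_of_avgIterZ L (fun x => unitaryUnits_le_U1 (hu x)) W i z μ

end Oscillation

#print axioms exists_blockConstant_dented
#print axioms exists_blockConstant_dented_mem
#print axioms norm_centre_sub_centre_le_of_avgIterZ

end Literature.MathematicalPhysics.QuantumFieldTheory.Balaban1983to89.B8BlockConstantLiftDentedRec

end
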